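import Mathlib.Data.ZMod.Basic
import Mathlib.Data.ZMod.Units
import Mathlib.Algebra.BigOperators.Intervals
import Mathlib.Order.Interval.Finset.Nat

/-!
# `𝒢_θ`: the level-`p^e` abelian arithmetic of the escape ((c5-alg) of brick R6-level, FRONTIER «REFUTE-F1732»)

Mochizuki, *Semi-graphs of anabelioids*, Publ. RIMS **42** (2006), Thm 3.7 (iii), author's manuscript p. 41
[cite: MochizukiSemiAnbd2006, Thm 3.7(iii) p.41] («every compact subgroup of `π₁^temp(𝒢)` is contained in at
least one verticial subgroup»; print proves the FINITE-`𝔾` case — kernel p431007).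

abc-iut cell, layer L3, FRONTIER programme `plan/L3/SUBDAG-SemiAnbd-Thm37iii-REFUTE.md` (erratum-grade; honest
framing α59: towards a kernel erratum for the ∀-countable reading of Thm 3.7 (iii) ([IUTchI] Rmk 2.5.3); desk
countermodel `𝒢_θ` by abc-iut-L3-d1 g3, memo sha16 8b26b5199c29f55f).  PROOF-ONLY file (0 definitions, 0 named
facts; Mathlib-only), seat abc-iut-w6-d096, sub-brick **(c5-alg)** of abc-iut-L3-d4's R6-level (the escape at a
finite level): at level `p^e` the `c_j`-fixed vertices lie over positions `≥ m_j − 1`, because a fixed edge lower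
down would force an equality of abelianised images that the following arithmetic forbids.

Memo §(2c)/(BS5): in the level quotient `Q` with its abelianisation `π : Q → (ℤ/p^e)²` (`π a = (1,0)`,
`π b = (0,1)`), the upper gluing carries `a` and the lower gluing at `v_k` carries `a·b^{p^{n_k}}`; a common fixed
edge gives `π((a b^{p^m})^λ) = π(f a^μ f⁻¹)` with `λ` a unit, i.e. `λ·(1, p^m) = μ·(1, 0)` in `(ℤ/p^e)²`:

* `ZMod.le_of_isUnit_mul_prime_pow_eq_zero` — `λ` a unit, `λ·p^m = 0` in `ℤ/p^e` ⇒ `e ≤ m`;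
* `ZMod.eq_and_le_of_smul_pair_eq` — `λ·(1, p^m) = μ·(1, 0)`, `λ` a unit ⇒ `λ = μ` and `e ≤ m`;
* `le_of_map_pow_eq_map_conj_pow` — the GROUP-level form over any `π : Q →* (ℤ/p^e)²` with `π a = (1,0)`,
  `π b = (0,1)` (conjugation is invisible in the abelian target);
* the CUMULATIVE-twist variant (abc-iut-L3-d2's reading (2), gluings composed along the ray, `b`-exponent
  `S_m = Σ_{i<m} p^{n_i}`): `Nat.not_pow_dvd_sum_pow_of_lt` — for `n` strictly increasing, `a < b`, `n a < r`,
  `p^r ∤ Σ_{i∈[a,b)} p^{n_i}` (the `i = a` term has the strictly smallest valuation), and its `ZMod (p^r)` form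
  `ZMod.natCast_sum_pow_ne_zero`.

v2 (append): `hsep_of_abelianisation(_zmod)` — the `hsep` binder of abc-iut-L3-d4's
`SemiGraph.ray_not_critical_of_characters` in binder form over the gluings and the two level maps.

Nothing here is specific to `𝒢_θ`; nothing asserts or refutes anything of [SemiAnbd]; no side taken on [IUTchIII]
Cor. 3.12; nothing here bears on abc.
-/

namespace Literature.AnabelianGeometry.SemiGraphs

namespace FreeProPTwo

open Finset

/-! ### `λ·(1, p^m) = μ·(1, 0)` in `(ℤ/p^e)²` -/

/-- **In `ℤ/p^e`: a unit times `p^m` vanishes only if `e ≤ m`.** [cite: MochizukiSemiAnbd2006, Thm 3.7(iii) p.41] -/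
theorem ZMod.le_of_isUnit_mul_prime_pow_eq_zero {p : ℕ} (hp : p.Prime) {e m : ℕ} {l : ZMod (p ^ e)}
    (hl : IsUnit l) (h : l * (p : ZMod (p ^ e)) ^ m = 0) : e ≤ m := by
  have h0 : ((p : ZMod (p ^ e)) ^ m) = 0 := by
    obtain ⟨u, rfl⟩ := hl
    simpa using congrArg (fun x => (↑u⁻¹ : ZMod (p ^ e)) * x) h
  have hdvd : p ^ e ∣ p ^ m := by
    rw [← Nat.cast_pow, ZMod.natCast_eq_zero_iff] at h0
    exact h0
  exact (Nat.pow_dvd_pow_iff_le_right hp.one_lt).mp hdvd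

/-- **`λ·(1, p^m) = μ·(1, 0)` in `(ℤ/p^e)²` with `λ` a unit forces `λ = μ` and `e ≤ m`** — the abelianised
«a fixed edge below height `m − 1` is impossible at level `p^e`». [cite: MochizukiSemiAnbd2006, Thm 3.7(iii) p.41] -/
theorem ZMod.eq_and_le_of_smul_pair_eq {p : ℕ} (hp : p.Prime) {e m : ℕ} {l μ : ZMod (p ^ e)} (hl : IsUnit l)
    (h : l • ((1 : ZMod (p ^ e)), (p : ZMod (p ^ e)) ^ m) = μ • ((1 : ZMod (p ^ e)), (0 : ZMod (p ^ e)))) :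
    l = μ ∧ e ≤ m := by
  simp only [Prod.smul_mk, smul_eq_mul, mul_one, mul_zero, Prod.mk.injEq] at h
  exact ⟨h.1, ZMod.le_of_isUnit_mul_prime_pow_eq_zero hp hl h.2⟩

/-- A natural number prime to `p` is a unit in `ℤ/p^e` (how the exponent `λ` of a generator of an edge group is
known to be a unit). [cite: MochizukiSemiAnbd2006, Thm 3.7(iii) p.41] -/
theorem ZMod.isUnit_natCast_of_not_dvd {p : ℕ} [Fact p.Prime] {e : ℕ} (l : ℕ) (hl : ¬ p ∣ l) :
    IsUnit (l : ZMod (p ^ e)) := by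
  rw [ZMod.isUnit_iff_coprime]
  exact Nat.Coprime.pow_right e ((Nat.Prime.coprime_iff_not_dvd Fact.out).mpr hl).symm

/-! ### The group-level form over a level abelianisation `π : Q → (ℤ/p^e)²` -/

/-- **(c5-alg), group level.**  In a group `Q` with a homomorphism `π : Q → (ℤ/p^e)²` (written multiplicatively)
such that `π a = (1,0)`, `π b = (0,1)`: if `(a·b^{p^m})^λ` and `f·a^μ·f⁻¹` have the same image under `π` and
`λ` is a unit mod `p^e`, then `λ ≡ μ (mod p^e)` and `e ≤ m`.  (Any finer `ψ` through which `π` factors gives the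
same conclusion from `ψ x = ψ y` by applying the factor map.) [cite: MochizukiSemiAnbd2006, Thm 3.7(iii) p.41] -/
theorem le_of_map_pow_eq_map_conj_pow {p : ℕ} (hp : p.Prime) {e m : ℕ} {Q : Type*} [Group Q]
    (π : Q →* Multiplicative (ZMod (p ^ e) × ZMod (p ^ e))) {a b f : Q}
    (ha : (π a).toAdd = (1, 0)) (hb : (π b).toAdd = (0, 1)) {l μ : ℤ} (hl : IsUnit ((l : ZMod (p ^ e))))
    (h : π ((a * b ^ (p ^ m)) ^ l) = π (f * a ^ μ * f⁻¹)) :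
    ((l : ZMod (p ^ e)) = μ) ∧ e ≤ m := by
  -- conjugation is invisible in the abelian target
  have hconj : π (f * a ^ μ * f⁻¹) = π (a ^ μ) := by
    rw [map_mul, map_mul, map_inv, mul_comm (π f) (π (a ^ μ)), mul_assoc, mul_inv_cancel, mul_one]
  have hab : (π (a * b ^ (p ^ m))).toAdd = ((1 : ZMod (p ^ e)), (p : ZMod (p ^ e)) ^ m) := by
    rw [map_mul, map_pow, toAdd_mul, toAdd_pow, ha, hb, Prod.smul_mk, Prod.mk_add_mk]
    simp
  have h1 : (π ((a * b ^ (p ^ m)) ^ l)).toAdd =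
      (l : ZMod (p ^ e)) • ((1 : ZMod (p ^ e)), (p : ZMod (p ^ e)) ^ m) := by
    rw [map_zpow, toAdd_zpow, hab, Prod.smul_mk, Prod.smul_mk, zsmul_eq_mul, zsmul_eq_mul, smul_eq_mul,
      smul_eq_mul]
  have h2 : (π (a ^ μ)).toAdd = (μ : ZMod (p ^ e)) • ((1 : ZMod (p ^ e)), (0 : ZMod (p ^ e))) := by
    rw [map_zpow, toAdd_zpow, ha, Prod.smul_mk, Prod.smul_mk, zsmul_eq_mul, zsmul_eq_mul, smul_eq_mul,
      smul_eq_mul]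
  have h3 := congrArg Multiplicative.toAdd (h.trans hconj)
  rw [h1, h2] at h3
  exact ZMod.eq_and_le_of_smul_pair_eq hp hl h3

/-- The same with the two elements compared under a finer homomorphism `ψ : Q → Q'` through which `π` factors
(`π = π' ∘ ψ`). [cite: MochizukiSemiAnbd2006, Thm 3.7(iii) p.41] -/
theorem le_of_map_pow_eq_map_conj_pow_of_comp {p : ℕ} (hp : p.Prime) {e m : ℕ} {Q Q' : Type*} [Group Q]
    [Group Q'] (ψ : Q →* Q') (π' : Q' →* Multiplicative (ZMod (p ^ e) × ZMod (p ^ e))) {a b f : Q}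
    (ha : (π' (ψ a)).toAdd = (1, 0)) (hb : (π' (ψ b)).toAdd = (0, 1)) {l μ : ℤ}
    (hl : IsUnit ((l : ZMod (p ^ e)))) (h : ψ ((a * b ^ (p ^ m)) ^ l) = ψ (f * a ^ μ * f⁻¹)) :
    ((l : ZMod (p ^ e)) = μ) ∧ e ≤ m :=
  le_of_map_pow_eq_map_conj_pow hp (π'.comp ψ) (a := a) (b := b) (f := f) ha hb hl
    (by simpa only [MonoidHom.comp_apply] using congrArg π' h)

/-! ### Cumulative twists: a sum of DISTINCT powers of `p` has the valuation of its smallest term -/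

/-- For a strictly increasing `n : ℕ → ℕ` and `a < b`, `p^{n a + 1}` does NOT divide `Σ_{i ∈ [a,b)} p^{n i}`.
[cite: MochizukiSemiAnbd2006, Thm 3.7(iii) p.41] -/
theorem Nat.not_pow_succ_dvd_sum_pow {p : ℕ} (hp : p.Prime) {n : ℕ → ℕ} (hn : StrictMono n) {a b : ℕ}
    (hab : a < b) : ¬ p ^ (n a + 1) ∣ ∑ i ∈ Ico a b, p ^ n i := by
  intro h
  rw [Finset.sum_eq_sum_Ico_succ_bot hab] at h
  have htail : p ^ (n a + 1) ∣ ∑ i ∈ Ico (a + 1) b, p ^ n i := by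
    refine Finset.dvd_sum fun i hi => pow_dvd_pow p ?_
    have hi' : a < i := by have := (Finset.mem_Ico.mp hi).1; omega
    exact hn hi'
  have hhead : p ^ (n a + 1) ∣ p ^ n a := (Nat.dvd_add_left htail).mp h
  have := (Nat.pow_dvd_pow_iff_le_right hp.one_lt).mp hhead
  omega

/-- **`p^r ∤ Σ_{i ∈ [a,b)} p^{n i}` whenever `n a < r`** (`n` strictly increasing, `a < b`) — abc-iut-L3-d2's
cumulative-twist form of the level arithmetic («`S_m − S_{h+1} = Σ_{h+1 ≤ i < m} p^{n_i} ≢ 0 (mod p^r)` since the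
sum has valuation `n_{h+1} < r`»). [cite: MochizukiSemiAnbd2006, Thm 3.7(iii) p.41] -/
theorem Nat.not_pow_dvd_sum_pow_of_lt {p : ℕ} (hp : p.Prime) {n : ℕ → ℕ} (hn : StrictMono n) {a b r : ℕ}
    (hab : a < b) (hr : n a < r) : ¬ p ^ r ∣ ∑ i ∈ Ico a b, p ^ n i := fun h =>
  Nat.not_pow_succ_dvd_sum_pow hp hn hab ((pow_dvd_pow p (Nat.succ_le_of_lt hr)).trans h)

/-- The `ZMod (p^r)` form: `Σ_{i ∈ [a,b)} p^{n i} ≠ 0` in `ℤ/p^r` when `n a < r`.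
[cite: MochizukiSemiAnbd2006, Thm 3.7(iii) p.41] -/
theorem ZMod.natCast_sum_pow_ne_zero {p : ℕ} (hp : p.Prime) {n : ℕ → ℕ} (hn : StrictMono n) {a b r : ℕ}
    (hab : a < b) (hr : n a < r) : ((∑ i ∈ Ico a b, p ^ n i : ℕ) : ZMod (p ^ r)) ≠ 0 := by
  rw [Ne, ZMod.natCast_eq_zero_iff]
  exact Nat.not_pow_dvd_sum_pow_of_lt hp hn hab hr

/-! ### v2 (append): the `hsep` binder of abc-iut-L3-d4's `SemiGraph.ray_not_critical_of_characters` -/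

/-- In `ℤ/p^e`, `p^m ≠ 0` when `m < e`. [cite: MochizukiSemiAnbd2006, Thm 3.7(iii) p.41] -/
theorem ZMod.prime_pow_ne_zero_of_lt {p : ℕ} (hp : p.Prime) {e m : ℕ} (h : m < e) :
    ((p : ZMod (p ^ e)) ^ m) ≠ 0 := by
  intro h0
  rw [← Nat.cast_pow, ZMod.natCast_eq_zero_iff] at h0
  exact absurd ((Nat.pow_dvd_pow_iff_le_right hp.one_lt).mp h0) (not_le.mpr h)

/-- A unit times a non-zero element of a commutative ring is non-zero (plumbing). [cite: MochizukiSemiAnbd2006, Thm 3.7(iii) p.41] -/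
theorem mul_ne_zero_of_isUnit_left {R : Type*} [CommRing R] {u d : R} (hu : IsUnit u) (hd : d ≠ 0) :
    u * d ≠ 0 := by
  intro h
  obtain ⟨v, rfl⟩ := hu
  exact hd (by simpa using congrArg (fun x => (↑v⁻¹ : R) * x) h)

/-- **The `hsep` binder of `SemiGraph.ray_not_critical_of_characters` (abc-iut-L3-d4, R6-level (c5)), produced from the
abelianisation alone, BINDER form.**  Gluings `up`, `low : E → G` (at `𝒢_θ`'s vertex `v_k`: `up = α`,
`low = θ_{n_k} ∘ α`), a level abelianisation `ab : G → R × R` and a level character `χ : G → R` (`R = ℤ/p^e`: d019's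
`abMod e`, `χaMod e`) such that `ab ∘ up = (χ ∘ up, 0)` and `ab ∘ low = (χ ∘ low, (χ ∘ low)·d)` with `d ≠ 0` (for
`𝒢_θ`: `d = p^{n_k}`, non-zero iff `n_k < e`), and `χ (up e₀)` a unit (the generator: `χ a = 1`).  Then an `up`-element
and a `low`-element with the character value of `up e₀` have DIFFERENT abelianisations — their second coordinates are
`0` and `unit·d ≠ 0`. [cite: MochizukiSemiAnbd2006, Thm 3.7(iii) p.41] -/
theorem hsep_of_abelianisation {G E R : Type*} [Group G] [CommRing R] (up low : E → G)
    (ab : G →* Multiplicative (R × R)) (χ : G →* Multiplicative R) (e₀ : E) {d : R}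
    (hup : ∀ t, (ab (up t)).toAdd = ((χ (up t)).toAdd, 0))
    (hlow : ∀ t, (ab (low t)).toAdd = ((χ (low t)).toAdd, (χ (low t)).toAdd * d))
    (hunit : IsUnit (χ (up e₀)).toAdd) (hd : d ≠ 0) :
    ∀ t₁ t₂ : E, χ (low t₁) = χ (up e₀) → χ (up t₂) = χ (up e₀) → ab (low t₁) ≠ ab (up t₂) := by
  intro t₁ t₂ h₁ _ heq
  have h2 := congrArg (fun x => (Multiplicative.toAdd x).2) heq
  simp only [hlow, hup] at h2
  rw [h₁] at h2
  exact mul_ne_zero_of_isUnit_left hunit hd h2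

/-- **`hsep` for `𝒢_θ` at level `p^e` with `n_k < e`**, still binder form in the gluings and the two level maps:
`R = ℤ/p^e`, `d = p^{n_k}`. [cite: MochizukiSemiAnbd2006, Thm 3.7(iii) p.41] -/
theorem hsep_of_abelianisation_zmod {p : ℕ} (hp : p.Prime) {e nk : ℕ} (hlt : nk < e) {G E : Type*} [Group G]
    (up low : E → G) (ab : G →* Multiplicative (ZMod (p ^ e) × ZMod (p ^ e)))
    (χ : G →* Multiplicative (ZMod (p ^ e))) (e₀ : E)
    (hup : ∀ t, (ab (up t)).toAdd = ((χ (up t)).toAdd, 0))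
    (hlow : ∀ t, (ab (low t)).toAdd = ((χ (low t)).toAdd, (χ (low t)).toAdd * (p : ZMod (p ^ e)) ^ nk))
    (hunit : IsUnit (χ (up e₀)).toAdd) :
    ∀ t₁ t₂ : E, χ (low t₁) = χ (up e₀) → χ (up t₂) = χ (up e₀) → ab (low t₁) ≠ ab (up t₂) :=
  hsep_of_abelianisation up low ab χ e₀ hup hlow hunit (ZMod.prime_pow_ne_zero_of_lt hp hlt)

end FreeProPTwo

end Literature.AnabelianGeometry.SemiGraphs
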